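import Literature.Analysis.FluidPDE.AxisymNoSwirlScaleInvariantBounds
import Literature.Analysis.FluidPDE.BiotSavartBounds
import Literature.Analysis.FluidPDE.BiotSavartRepresentationSqIntegrable
import HarnessLib

/-!
# The axisymmetric Biot–Savart bound for the radial velocity,
# `‖u_r/r‖_∞ ≤ C ‖ω_θ‖_{L¹(Ω)}^{1/3} ‖ω_θ/r‖_{L^∞}^{2/3}` (Gallay–Šverák 2015, Prop. 2.6 (2.15)) —
# proved, with `C` explicit

Analysis/FluidPDE proof file (theorems only; no definitions, no named facts; net debt `0`). It
proves the second estimate of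

> Th. Gallay, V. Šverák, *Remarks on the Cauchy problem for the axisymmetric Navier–Stokes
> equations*, Confluentes Math. **7** (2015) 67–92 = arXiv:1510.01036, **Proposition 2.6**, p. 8:
> "`‖u‖_{L^∞(Ω)} ≤ C ‖rω_θ‖_{L¹(Ω)}^{1/2} ‖ω_θ/r‖_{L^∞(Ω)}^{1/2}` (2.14),
> `‖u_r/r‖_{L^∞(Ω)} ≤ C ‖ω_θ‖_{L¹(Ω)}^{1/3} ‖ω_θ/r‖_{L^∞(Ω)}^{2/3}` (2.15)",

for the velocity `u` defined from the azimuthal vorticity `ω_θ` by the axisymmetric Biot–Savart law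
(2.8) (= the Biot–Savart law of `ℝ³`, Majda–Bertozzi's `K₃ ∗ ω`, tree `biotSavart`, for
`ω = ω_θ e_θ`), `Ω = {(r, z) : r > 0}` with the measure `dr dz`. Estimate (2.14) is the tree theorem
`norm_biotSavart_le_sqrt_of_norm_le_mul_cylRadius` (`AxisymBiotSavartSupBound.lean`, whose module
docstring lists (2.15) under "What is NOT here"); (2.15) is the kinematic input of the energy
estimate (5.8) in the proof of Prop. 5.3 (= the named fact `GallaySverak2015.VorticitySupBound`,
`AxisymNoSwirlScaleInvariantBounds.lean`, p. 17: "`‖u_r(t)/r‖_∞ ≤ C‖ω_θ(t)‖_{L¹(Ω)}^{1/3}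
‖ω_θ(t)/r‖_∞^{2/3} ≤ CM/t`"), which stays a fact.

## Rendering (dictionary as in `AxisymNoSwirlScaleInvariantBounds`: `dx = r dr dθ dz`)

The azimuthal field is written `w(y) = η(y) · J y` with `J y = (−y₁, y₀, 0) = r e_θ` (`rotGen`) and
`η = ω_θ/r` an axisymmetric scalar (`IsAxisymmetricScalar η`); for an axisymmetric swirl-free
`v ∈ C³` this is exactly `curl v` with `η = angVortQuot v` (`curl_eq_angVortQuot_smul_rotGen`). Then
`‖ω_θ/r‖_{L^∞(Ω)} = sup|η| ≤ M` and `∫_{ℝ³} |η| dx = 2π ‖ω_θ‖_{L¹(Ω)}`. The radial velocity is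
`radialVelocity u x = ⟪u x, e_r x⟫`, the radial momentum `x₀u₀ + x₁u₁ = r u_r`, and the smooth
quotient `radVelQuot u = u_r/r` (`AxisymHouLiVariables`).

## Contents (all proved)

* `abs_inner_biotSavart_smul_rotGen_le_of_scale` — **the bound at scale `R`**: for `η ∈ L¹(ℝ³)`
  axisymmetric with `|η| ≤ M`, every horizontal covector `c` (`c₂ = 0`), every `x` and `R > 0`:
  `|⟪c, (K₃ ∗ w)(x)⟫| ≤ ‖c‖ r(x) (4MR + (πR²)⁻¹ ∫|η|)`;
* `abs_inner_biotSavart_smul_rotGen_le` — **(2.15) with an explicit constant**: optimising,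
  `|⟪c, (K₃ ∗ w)(x)⟫| ≤ (9/2) ‖c‖ (∫|η| · M²)^{1/3} r(x)`, whence (`c = e₀, e₁`, `c = (x₀, x₁, 0)`,
  `c = u_h(x)`): `abs_biotSavart_smul_rotGen_apply_le` (horizontal components),
  `abs_horizontal_inner_biotSavart_smul_rotGen_le` (`|x₀u₀ + x₁u₁| ≤ (9/2)(∫|η| M²)^{1/3} r²`),
  `sqrt_sq_add_sq_biotSavart_smul_rotGen_le` (`√(u₀² + u₁²) ≤ (9/2)(∫|η| M²)^{1/3} r`),
  `abs_radialVelocity_biotSavart_smul_rotGen_le` (`|u_r| ≤ (9/2)(∫|η| M²)^{1/3} r`). In the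
  paper's units (`∫|η| dx = 2π‖ω_θ‖_{L¹(Ω)}`): **(2.15) holds with `C = (9/2)(2π)^{1/3}`**;
* `curl_eq_angVortQuot_smul_rotGen`, `abs_radialVelocity_biotSavart_curl_le` — the same for
  `w = curl v`, `v ∈ C³` axisymmetric swirl-free with `η = angVortQuot v ∈ L¹`, `|η| ≤ L`;
* `IsTaoSolutionOn.abs_radialVelocity_le_of_abs_angVortQuot_le`,
  `IsTaoSolutionOn.abs_radVelQuot_le_of_abs_angVortQuot_le` — **(2.15) along swirl-free
  axisymmetric Tao-class flows** (`ν > 0`, datum with `η₀ ∈ L¹(ℝ³)`, any `t ∈ [0, T]`, any bound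
  `|η(t)| ≤ L`): `|u_r(t,x)| ≤ (9/2)(∫|η₀| · L²)^{1/3} r(x)`,
  `|x₀u₀ + x₁u₁|(t,x) ≤ (9/2)(∫|η₀| · L²)^{1/3} r(x)²`, and `|(u_r/r)(t,x)| ≤ (9/2)(∫|η₀| · L²)^{1/3}`
  for EVERY `x` — via the slice representation `u(t) = K₃ ∗ ω(t)`
  (`IsTaoSolutionOn.biotSavart_curl_eq_self`, `BiotSavartRepresentationSqIntegrable`) and Lemma 5.1
  `∫|η(t)| ≤ ∫|η₀|` (`IsTaoSolutionOn.lintegral_abs_angVortQuot_le_of_datum`).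

## The proof (not the paper's)

The paper (p. 8–9) estimates the axisymmetric kernel `G_r` of (2.11) through the bounds
`|F'(s)| ≤ C/s`, `|F'(s)| ≤ C s^{-5/2}` of Lemma 2.1 on the regions `I₁`, `I₂`; its Remark 2.7 notes
the alternative `‖u_r/r‖_{L^∞(ℝ³)} ≤ C‖ω_θ/r‖_{L^{3,1}(ℝ³)}` (Abidi–Hmidi–Keraani). Here, an
elementary three-dimensional argument in the spirit of the latter. With
`K₃(z) h = (4π|z|³)⁻¹ h × z` (`biotSavartKernel`) and `(J y) × (x − y) = ((x₂−y₂)y₀, (x₂−y₂)y₁, ·)`,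
for a horizontal covector `c`:
`⟪c, K₃(x − y) w(y)⟫ = (4π|x − y|³)⁻¹ η(y) (x₂ − y₂) (c₀y₀ + c₁y₁) =: Φ_x(y)`
(`inner_biotSavartKernel_smul_rotGen`), so `⟪c, u(x)⟫ = ∫ Φ_x` (`integral_inner`; if the
Biot–Savart integrand is not integrable both sides vanish by the Bochner convention).
(i) **Cancellation on the axis**: at the axis point `x' = (0, 0, x₂)` below `x`, `∫ Φ_{x'} = 0`,
because `Φ_{x'}` is odd under the half-turn `y ↦ R_π y = (−y₀, −y₁, y₂)` (`η` is invariant,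
`|x' − R_π y| = |x' − y|`, `c₀y₀ + c₁y₁` changes sign), a volume-preserving map (`rotZLIE`)
(`integral_radialIntegrand_axis_eq_zero`). Hence `⟪c, u(x)⟫ = ∫ (Φ_x − Φ_{x'})` (both integrable,
`integrable_radialIntegrand`: `|Φ_ξ(y)| ≤ (4π)⁻¹‖c‖(r(ξ)+1)(M·1_{|ξ−y|<1}|ξ−y|⁻² + |η(y)|)`).
(ii) **Pointwise**: with `a = |x − y|`, `b = |x' − y|`: `|a − b| ≤ |x − x'| = r(x)`,
`|x₂ − y₂| ≤ min(a, b)`, `|c₀y₀ + c₁y₁| ≤ ‖c‖ r(y) ≤ ‖c‖ b`, and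
`|a⁻³ − b⁻³| = |a − b|(a² + ab + b²)/(a³b³)`; since `s(a² + ab + b²) ≤ 2a(a² + b²)` for
`0 ≤ s ≤ min(a,b)`, one gets `|Φ_x(y) − Φ_{x'}(y)| ≤ (4π)⁻¹ ‖c‖ · 2r(x) · |η(y)| (a⁻² + b⁻²)`
(`abs_radialIntegrand_sub_axis_le`).
(iii) **Integration**: `∫ |η(y)| |ξ − y|⁻² dy ≤ 4πMR + R⁻² ∫|η|` for every `R > 0`
(`lintegral_enorm_mul_inv_norm_sq_le_of_scale`: `|z|⁻² ≤ 1_{|z|<R}|z|⁻² + R⁻²`, `|η| ≤ M` near,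
`∫_{|z|<R}|z|⁻² dz = 4πR` — `lintegral_kernelMajorant` of `BiotSavartBounds` — and `∫|η|` far), at
`ξ = x` and `ξ = x'`. Total: `|⟪c, u(x)⟫| ≤ (r(x)/π)(4πMR + R⁻²∫|η|)`, and `R = (∫|η|/M)^{1/3}` gives
`(4 + 1/π)(∫|η| M²)^{1/3} r(x) ≤ (9/2)(∫|η| M²)^{1/3} r(x)`.

## What is NOT here

The general `L^p`–`L^q` bounds of Prop. 2.3 (i), Prop. 2.4 (weighted), Remark 2.5, the kernel
estimates (2.11)–(2.13) through `F`, `F'`, and the Lorentz-space form of Remark 2.7; the dynamic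
facts Prop. 5.3 (`GallaySverak2015.VorticitySupBound`) and (1.12) (`GallaySverak2015.VelocitySupDecay`,
now `⇐ VorticitySupBound` by `velocitySupDecay_of_vorticitySupBound`) are untouched — this file is
one kinematic input ((2.15)) of the printed proof of Prop. 5.3 (the others being the semigroup
bounds of §3, the recursion of §4.1, Nash's inequality on `Ω` and Feng–Šverák's Lemma 5.2).

## Mathlib / tree search

`lean search '(2.15)|u_r/r|radVelQuot.*biotSavart|radialVelocity.*biotSavart'` (2026-08-27): (2.15)
appears only in the TODO lists of `AxisymBiotSavartSupBound` / `AxisymNoSwirlScaleInvariantBounds`;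
no bound on the radial component of a Biot–Savart velocity in the tree. Tree (used):
`biotSavart`, `biotSavartKernel`, `biotSavart_zero`, `cross` (`Vorticity`, `VectorCalculus`);
`kernelMajorant`, `integrable_kernelMajorant`, `lintegral_kernelMajorant`,
`norm_sub_sq_inv_le_kernelMajorant_add` (`BiotSavartBounds`); `rotZ`, `norm_rotZ`, `cylRadius`,
`cylRadius_sq`, `cylRadius_eq_zero_iff`, `IsAxisymmetric`, `IsAxisymmetricScalar`, `eR`,
`radialVelocity` (`AxisymmetricEuler`); `rotZLIE` (`AxisymmetricVorticityTransport`); `rotGen`,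
`norm_rotGen` (`SwirlTransportProofs`, `AxisymVorticityAlgebra`); `rotZ_eq_self_of_axis`,
`curl_eq_hadamardQuotFst_smul_rotGen` (`AxisymNoSwirlVorticity`); `angVortQuot`, `radVelQuot`,
`contDiff_angVortQuot`, `contDiff_radVelQuot`, `IsAxisymmetric.isAxisymmetricScalar_angVortQuot`,
`IsAxisymmetric.cylRadius_sq_mul_radVelQuot` (`AxisymHouLiVariables`);
`angVortQuot_eq_hadamardQuotFst_curl`, `IsTaoSolutionOn.lintegral_abs_angVortQuot_le_of_datum`
(`AxisymNoSwirlCoSignedFlux`); `IsTaoSolutionOn.isAxisymmetric`, `…hasNoSwirl`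
(`AxisymmetricNoSwirlGlobal`); `IsTaoSolutionOn.biotSavart_curl_eq_self`
(`BiotSavartRepresentationSqIntegrable`). The small lemmas `cross_apply_zero/one/two`,
`real_inner_fin3` (`TaoAveragedNondegeneracy`), `rotZ_pi`, `measurePreserving_rotZ`
(`KNSSAxisymmetricNoSwirl`) and `cylRadius_le_cylRadius_add_norm_sub` (private in
`AxisymBiotSavartSupBound`) exist in files not imported here and are re-proved privately to keep the
import closure small. Mathlib: `integral_inner`, `integral_undef`, `MeasurePreserving.integral_comp`,
`enorm_integral_le_lintegral_enorm`, `lintegral_sub_left_eq_self`, `Integrable.comp_sub_left`,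
`ofReal_integral_norm_eq_lintegral_enorm`, `abs_norm_sub_norm_le`, `Real.rpow_inv_natCast_pow`,
`EuclideanSpace.inner_single_left`, `PiLp.norm_single`, `tendsto_one_div_add_atTop_nhds_zero_nat`.

## References

* Th. Gallay, V. Šverák, *Remarks on the Cauchy problem for the axisymmetric Navier–Stokes
  equations*, Confluentes Math. 7 (2015) 67–92 = arXiv:1510.01036: §1 (1.3), (1.6) (pp. 2–3),
  Prop. 2.6 (2.14)–(2.15) and its proof (pp. 8–9), Remark 2.7 (p. 9), Lemma 5.1 (p. 16), proof of
  Prop. 5.3 (p. 17). [GallaySverak2016]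
* H. Feng, V. Šverák, *On the Cauchy problem for axi-symmetric vortex rings*, Arch. Ration.
  Mech. Anal. 215 (2015) 89–123 (the method of Prop. 2.6, cited there as [FS]).
* H. Abidi, T. Hmidi, S. Keraani, *On the global well-posedness for the axisymmetric Euler
  equations*, Math. Ann. 347 (2010) 15–41 (the Lorentz-space bound of Remark 2.7, [AHK]).
* A. J. Majda, A. L. Bertozzi, *Vorticity and Incompressible Flow*, CUP 2002, (2.10)–(2.12)
  (the Biot–Savart law `K₃`). [MajdaBertozziCUP2002]
-/

noncomputable section

open MeasureTheory Set Function Filter Metric Real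
open _root_.Topology
open scoped ENNReal NNReal RealInnerProductSpace

namespace Literature.Analysis.FluidPDE

/-! ### Coordinates: the cross product, the inner product and the kernel pairing -/

section Algebra

/-- First coordinate of the cross product. [folklore] -/
private theorem cross_apply_zero' (a b : EuclideanSpace ℝ (Fin 3)) :
    cross a b 0 = a 1 * b 2 - a 2 * b 1 := by
  simp [cross, cross_apply]

/-- Second coordinate of the cross product. [folklore] -/
private theorem cross_apply_one' (a b : EuclideanSpace ℝ (Fin 3)) :
    cross a b 1 = a 2 * b 0 - a 0 * b 2 := by
  simp [cross, cross_apply]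

/-- Third coordinate of the cross product. [folklore] -/
private theorem cross_apply_two' (a b : EuclideanSpace ℝ (Fin 3)) :
    cross a b 2 = a 0 * b 1 - a 1 * b 0 := by
  simp [cross, cross_apply]

/-- The real inner product on `ℝ³` in coordinates. [folklore] -/
private theorem real_inner_fin3' (a b : EuclideanSpace ℝ (Fin 3)) :
    ⟪a, b⟫ = a 0 * b 0 + a 1 * b 1 + a 2 * b 2 := by
  simp [PiLp.inner_apply, Fin.sum_univ_three, mul_comm]

/-- **The horizontal part of the Biot–Savart integrand of an azimuthal field.** For
`w(y) = a · J y` (`J y = (−y₁, y₀, 0)`), a horizontal covector `c` (`c₂ = 0`) and all `x, y`: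
`⟪c, K₃(x − y) w(y)⟫ = (4π|x − y|³)⁻¹ · a · (x₂ − y₂) · (c₀y₀ + c₁y₁)`
(from `(J y) × (x − y) = ((x₂−y₂)y₀, (x₂−y₂)y₁, −(y₀(x₀−y₀) + y₁(x₁−y₁)))`). [folklore] -/
private theorem inner_biotSavartKernel_smul_rotGen {c : EuclideanSpace ℝ (Fin 3)} (hc : c 2 = 0)
    (a : ℝ) (x y : EuclideanSpace ℝ (Fin 3)) :
    ⟪c, biotSavartKernel (x - y) (a • rotGen y)⟫ =
      (4 * π * ‖x - y‖ ^ 3)⁻¹ * a * (x 2 - y 2) * (c 0 * y 0 + c 1 * y 1) := by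
  rw [biotSavartKernel, real_inner_smul_right, real_inner_fin3', cross_apply_zero',
    cross_apply_one', hc]
  simp only [PiLp.smul_apply, PiLp.sub_apply, rotGen_apply_zero, rotGen_apply_one,
    rotGen_apply_two, smul_eq_mul]
  ring

/-- A coordinate is bounded by the norm: `|v i| ≤ ‖v‖`. [folklore] -/
private theorem abs_coord_le_norm_r3 (v : EuclideanSpace ℝ (Fin 3)) (i : Fin 3) : |v i| ≤ ‖v‖ := by
  rw [EuclideanSpace.norm_eq, ← Real.sqrt_sq_eq_abs]
  refine Real.sqrt_le_sqrt ?_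
  have h := Finset.single_le_sum (f := fun j : Fin 3 => ‖v j‖ ^ 2) (fun j _ => sq_nonneg _)
    (Finset.mem_univ i)
  simpa only [Real.norm_eq_abs, sq_abs] using h

/-- The cylindrical radius is bounded by the norm: `r(v) ≤ ‖v‖`. [folklore] -/
private theorem cylRadius_le_norm_r3 (v : EuclideanSpace ℝ (Fin 3)) : cylRadius v ≤ ‖v‖ := by
  rw [cylRadius, EuclideanSpace.norm_eq]
  refine Real.sqrt_le_sqrt ?_
  simp only [Fin.sum_univ_three, Real.norm_eq_abs, sq_abs]
  nlinarith [sq_nonneg (v 2)]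

/-- **Two-dimensional Cauchy–Schwarz**: `|c₀y₀ + c₁y₁| ≤ ‖c‖ · r(y)`. [folklore] -/
private theorem abs_horizontal_pairing_le_norm_mul_cylRadius (c y : EuclideanSpace ℝ (Fin 3)) :
    |c 0 * y 0 + c 1 * y 1| ≤ ‖c‖ * cylRadius y := by
  have hc : c 0 ^ 2 + c 1 ^ 2 ≤ ‖c‖ ^ 2 := by
    rw [EuclideanSpace.norm_eq, Real.sq_sqrt (Finset.sum_nonneg fun i _ => sq_nonneg _)]
    simp only [Fin.sum_univ_three, Real.norm_eq_abs, sq_abs]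
    nlinarith [sq_nonneg (c 2)]
  have h1 : (c 0 * y 0 + c 1 * y 1) ^ 2 ≤ (‖c‖ * cylRadius y) ^ 2 := by
    rw [mul_pow, cylRadius_sq]
    nlinarith [sq_nonneg (c 0 * y 1 - c 1 * y 0), sq_nonneg (y 0), sq_nonneg (y 1),
      mul_le_mul_of_nonneg_right hc (add_nonneg (sq_nonneg (y 0)) (sq_nonneg (y 1)))]
  exact abs_le_of_sq_le_sq h1 (mul_nonneg (norm_nonneg _) (cylRadius_nonneg _))

end Algebra

/-! ### The half-turn about the axis -/

section HalfTurn

/-- The half-turn about the axis: `R_π y = (−y₀, −y₁, y₂)`. [folklore] -/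
private theorem rotZ_pi_apply (y : EuclideanSpace ℝ (Fin 3)) :
    rotZ π y 0 = -y 0 ∧ rotZ π y 1 = -y 1 ∧ rotZ π y 2 = y 2 := by
  simp [Real.cos_pi, Real.sin_pi]

/-- `R_θ (x − y) = R_θ x − R_θ y`. [folklore] -/
private theorem rotZ_sub'' (θ : ℝ) (x y : EuclideanSpace ℝ (Fin 3)) :
    rotZ θ (x - y) = rotZ θ x - rotZ θ y := by
  ext i
  fin_cases i <;> simp <;> ring

/-- Distances from a point of the axis are invariant under the rotations about the axis:
`‖x' − R_θ y‖ = ‖x' − y‖` if `x'₀ = x'₁ = 0`. [folklore] -/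
private theorem norm_axis_sub_rotZ {x' : EuclideanSpace ℝ (Fin 3)} (h0 : x' 0 = 0) (h1 : x' 1 = 0)
    (θ : ℝ) (y : EuclideanSpace ℝ (Fin 3)) : ‖x' - rotZ θ y‖ = ‖x' - y‖ := by
  conv_lhs => rw [← rotZ_eq_self_of_axis θ h0 h1, ← rotZ_sub'', norm_rotZ]

/-- Substitution `y ↦ R_π y` in a Bochner integral over `ℝ³` (a volume-preserving linear
isometry). [folklore] -/
private theorem integral_comp_rotZ_pi (g : EuclideanSpace ℝ (Fin 3) → ℝ) :
    ∫ y, g (rotZ π y) = ∫ y, g y := by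
  have hmp : MeasurePreserving (rotZ π) (volume : Measure (EuclideanSpace ℝ (Fin 3))) volume :=
    (rotZLIE π).measurePreserving
  have hme : MeasurableEmbedding (rotZ π) := (rotZLIE π).toHomeomorph.measurableEmbedding
  exact hmp.integral_comp hme g

end HalfTurn

/-! ### The scalar integrand and its oddness at the axis -/

section Integrand

variable {η : EuclideanSpace ℝ (Fin 3) → ℝ} {c : EuclideanSpace ℝ (Fin 3)}

/-- **Oddness at the axis.** For an axisymmetric scalar `η`, a horizontal covector `c` and a point
`x'` ON the axis, the scalar Biot–Savart integrand
`y ↦ (4π|x' − y|³)⁻¹ η(y) (x'₂ − y₂) (c₀y₀ + c₁y₁)` is odd under the half-turn `y ↦ R_π y`, so its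
integral vanishes: the horizontal velocity of an azimuthal axisymmetric vorticity field vanishes on
the axis. [folklore] -/
private theorem integral_radialIntegrand_axis_eq_zero (hax : IsAxisymmetricScalar η)
    {x' : EuclideanSpace ℝ (Fin 3)} (h0 : x' 0 = 0) (h1 : x' 1 = 0) :
    ∫ y, (4 * π * ‖x' - y‖ ^ 3)⁻¹ * η y * (x' 2 - y 2) * (c 0 * y 0 + c 1 * y 1) = 0 := by
  set g : EuclideanSpace ℝ (Fin 3) → ℝ :=
    fun y => (4 * π * ‖x' - y‖ ^ 3)⁻¹ * η y * (x' 2 - y 2) * (c 0 * y 0 + c 1 * y 1) with hg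
  have hodd : ∀ y, g (rotZ π y) = -g y := by
    intro y
    obtain ⟨e0, e1, e2⟩ := rotZ_pi_apply y
    simp only [hg, norm_axis_sub_rotZ h0 h1, hax π y, e0, e1, e2]
    ring
  have h := integral_comp_rotZ_pi g
  rw [show (fun y => g (rotZ π y)) = fun y => -g y from funext hodd, integral_neg] at h
  linarith

/-- **The pointwise cancellation.** For `x ∈ ℝ³` with axis projection `x' = (0, 0, x₂)` and every
`y`: the difference of the scalar integrands at `x` and at `x'` is bounded by
`(4π)⁻¹ ‖c‖ · 2 r(x) · |η(y)| · (|x − y|⁻² + |x' − y|⁻²)` — from `|c₀y₀ + c₁y₁| ≤ ‖c‖ r(y)`,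
`r(y) ≤ |x' − y|`, `|x₂ − y₂| ≤ min(|x − y|, |x' − y|)`, `| |x − y| − |x' − y| | ≤ |x − x'| = r(x)` and
the elementary inequality `s q |a⁻³ − b⁻³| ≤ 2ρ(a⁻² + b⁻²)` for `0 ≤ s ≤ min(a, b)`, `0 ≤ q ≤ b`,
`|a − b| ≤ ρ`. [folklore] -/
private theorem abs_radialIntegrand_sub_axis_le (η : EuclideanSpace ℝ (Fin 3) → ℝ)
    (c x y : EuclideanSpace ℝ (Fin 3)) :
    |(4 * π * ‖x - y‖ ^ 3)⁻¹ * η y * (x 2 - y 2) * (c 0 * y 0 + c 1 * y 1) -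
        (4 * π * ‖EuclideanSpace.single 2 (x 2) - y‖ ^ 3)⁻¹ * η y *
          ((EuclideanSpace.single 2 (x 2) : EuclideanSpace ℝ (Fin 3)) 2 - y 2) *
          (c 0 * y 0 + c 1 * y 1)| ≤
      (4 * π)⁻¹ * ‖c‖ * (2 * cylRadius x) * |η y| *
        ((‖x - y‖ ^ 2)⁻¹ + (‖EuclideanSpace.single 2 (x 2) - y‖ ^ 2)⁻¹) := by
  set x' : EuclideanSpace ℝ (Fin 3) := EuclideanSpace.single 2 (x 2) with hx'
  have hx'0 : x' 0 = 0 := by simp [hx']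
  have hx'1 : x' 1 = 0 := by simp [hx']
  have hx'2 : x' 2 = x 2 := by simp [hx']
  rw [hx'2]
  set a : ℝ := ‖x - y‖ with ha
  set b : ℝ := ‖x' - y‖ with hb
  have hRHS : 0 ≤ (4 * π)⁻¹ * ‖c‖ * (2 * cylRadius x) * |η y| * ((a ^ 2)⁻¹ + (b ^ 2)⁻¹) := by
    have := cylRadius_nonneg x
    positivity
  -- the degenerate case `x₂ = y₂`: both integrands vanish
  by_cases hs : x 2 - y 2 = 0
  · rw [hs]; simpa using hRHS
  have hs0 : 0 < |x 2 - y 2| := abs_pos.2 hs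
  -- `|x₂ − y₂| ≤ a, b`; in particular `a, b > 0`
  have hsa : |x 2 - y 2| ≤ a := by
    have := abs_coord_le_norm_r3 (x - y) 2
    simpa only [PiLp.sub_apply] using this
  have hsb : |x 2 - y 2| ≤ b := by
    have := abs_coord_le_norm_r3 (x' - y) 2
    simpa only [PiLp.sub_apply, hx'2] using this
  have ha0 : 0 < a := hs0.trans_le hsa
  have hb0 : 0 < b := hs0.trans_le hsb
  -- `r(y) ≤ b`, `|a − b| ≤ r(x)`
  have hqb : cylRadius y ≤ b := by
    have h1 : cylRadius y = cylRadius (x' - y) := by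
      simp only [cylRadius, PiLp.sub_apply, hx'0, hx'1, zero_sub, neg_sq]
    rw [h1]
    exact cylRadius_le_norm_r3 _
  have hab : |a - b| ≤ cylRadius x := by
    have h1 : |a - b| ≤ ‖(x - y) - (x' - y)‖ := abs_norm_sub_norm_le _ _
    have h2 : (x - y) - (x' - y) = x - x' := by abel
    have h3 : ‖x - x'‖ = cylRadius x := by
      rw [cylRadius, EuclideanSpace.norm_eq]
      congr 1
      simp [Fin.sum_univ_three, hx', PiLp.sub_apply]
    rw [h2, h3] at h1
    exact h1
  -- the elementary inequality
  have hρ : 0 ≤ cylRadius x := cylRadius_nonneg x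
  have key : (a ^ 3)⁻¹ - (b ^ 3)⁻¹ = (b - a) * (a ^ 2 + a * b + b ^ 2) / (a ^ 3 * b ^ 3) := by
    field_simp
    ring
  have habs : |(a ^ 3)⁻¹ - (b ^ 3)⁻¹| ≤ cylRadius x * (a ^ 2 + a * b + b ^ 2) / (a ^ 3 * b ^ 3) := by
    rw [key, abs_div, abs_mul, abs_of_pos (by positivity : 0 < a ^ 2 + a * b + b ^ 2),
      abs_of_pos (by positivity : 0 < a ^ 3 * b ^ 3), abs_sub_comm]
    gcongr
  have hsA : |x 2 - y 2| * (a ^ 2 + a * b + b ^ 2) ≤ 2 * a * (a ^ 2 + b ^ 2) := by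
    nlinarith [mul_le_mul_of_nonneg_right hsa (sq_nonneg a),
      mul_le_mul_of_nonneg_right hsb (mul_nonneg ha0.le hb0.le),
      mul_le_mul_of_nonneg_right hsa (sq_nonneg b), pow_pos ha0 3, mul_pos ha0 (sq_pos_of_pos hb0)]
  have hcore : |x 2 - y 2| * cylRadius y * |(a ^ 3)⁻¹ - (b ^ 3)⁻¹| ≤
      2 * cylRadius x * ((a ^ 2)⁻¹ + (b ^ 2)⁻¹) := by
    calc |x 2 - y 2| * cylRadius y * |(a ^ 3)⁻¹ - (b ^ 3)⁻¹|
        ≤ |x 2 - y 2| * b * (cylRadius x * (a ^ 2 + a * b + b ^ 2) / (a ^ 3 * b ^ 3)) := by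
          gcongr
      _ = cylRadius x * b * (|x 2 - y 2| * (a ^ 2 + a * b + b ^ 2)) / (a ^ 3 * b ^ 3) := by ring
      _ ≤ cylRadius x * b * (2 * a * (a ^ 2 + b ^ 2)) / (a ^ 3 * b ^ 3) := by gcongr
      _ = 2 * cylRadius x * ((a ^ 2)⁻¹ + (b ^ 2)⁻¹) := by
          field_simp
          ring
  -- assemble
  have hpair := abs_horizontal_pairing_le_norm_mul_cylRadius c y
  have hfac : (4 * π * a ^ 3)⁻¹ * η y * (x 2 - y 2) * (c 0 * y 0 + c 1 * y 1) -
      (4 * π * b ^ 3)⁻¹ * η y * (x 2 - y 2) * (c 0 * y 0 + c 1 * y 1) =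
      (4 * π)⁻¹ * (η y * ((x 2 - y 2) * (c 0 * y 0 + c 1 * y 1) * ((a ^ 3)⁻¹ - (b ^ 3)⁻¹))) := by
    rw [mul_inv, mul_inv]
    ring
  rw [hfac, abs_mul, abs_of_pos (by positivity : (0 : ℝ) < (4 * π)⁻¹), abs_mul, abs_mul, abs_mul]
  calc (4 * π)⁻¹ * (|η y| * (|x 2 - y 2| * |c 0 * y 0 + c 1 * y 1| * |(a ^ 3)⁻¹ - (b ^ 3)⁻¹|))
      ≤ (4 * π)⁻¹ * (|η y| * (|x 2 - y 2| * (‖c‖ * cylRadius y) * |(a ^ 3)⁻¹ - (b ^ 3)⁻¹|)) := by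
        gcongr
    _ = (4 * π)⁻¹ * ‖c‖ * |η y| * (|x 2 - y 2| * cylRadius y * |(a ^ 3)⁻¹ - (b ^ 3)⁻¹|) := by
        ring
    _ ≤ (4 * π)⁻¹ * ‖c‖ * |η y| * (2 * cylRadius x * ((a ^ 2)⁻¹ + (b ^ 2)⁻¹)) := by
        gcongr
    _ = (4 * π)⁻¹ * ‖c‖ * (2 * cylRadius x) * |η y| * ((a ^ 2)⁻¹ + (b ^ 2)⁻¹) := by ring

end Integrand

/-! ### Integrability of the scalar integrand and the bound `∫ |η| |ξ − y|⁻² ≤ 4πMR + A/R²` -/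

section Estimates

variable {η : EuclideanSpace ℝ (Fin 3) → ℝ} {M : ℝ}

/-- The cylindrical radius is `1`-Lipschitz: `r(y) ≤ r(ξ) + ‖ξ − y‖` (`r = ‖J ·‖`, `J` linear,
`r ≤ ‖·‖`). [folklore] -/
private theorem cylRadius_le_cylRadius_add_norm_sub' (ξ y : EuclideanSpace ℝ (Fin 3)) :
    cylRadius y ≤ cylRadius ξ + ‖ξ - y‖ := by
  have h : rotGen y = rotGen ξ - rotGen (ξ - y) := by
    ext i
    fin_cases i
    · simp [rotGen]; ring
    · simp [rotGen]
    · simp [rotGen]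
  have e1 : cylRadius y = ‖rotGen y‖ := (norm_rotGen y).symm
  have e2 : cylRadius ξ = ‖rotGen ξ‖ := (norm_rotGen ξ).symm
  have e3 : cylRadius (ξ - y) = ‖rotGen (ξ - y)‖ := (norm_rotGen (ξ - y)).symm
  rw [e1, e2, h]
  refine (norm_sub_le _ _).trans (add_le_add le_rfl ?_)
  rw [← e3]
  exact cylRadius_le_norm_r3 _

/-- The kernel factor `y ↦ (4π|ξ − y|³)⁻¹ (ξ₂ − y₂)(c₀y₀ + c₁y₁)` is measurable. [folklore] -/
private theorem measurable_radialKernelFactor (c ξ : EuclideanSpace ℝ (Fin 3)) :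
    Measurable fun y : EuclideanSpace ℝ (Fin 3) =>
      (4 * π * ‖ξ - y‖ ^ 3)⁻¹ * ((ξ 2 - y 2) * (c 0 * y 0 + c 1 * y 1)) := by
  have h0 : Continuous fun y : EuclideanSpace ℝ (Fin 3) => y 0 := PiLp.continuous_apply 2 _ 0
  have h1 : Continuous fun y : EuclideanSpace ℝ (Fin 3) => y 1 := PiLp.continuous_apply 2 _ 1
  have h2 : Continuous fun y : EuclideanSpace ℝ (Fin 3) => y 2 := PiLp.continuous_apply 2 _ 2
  have hn : Continuous fun y : EuclideanSpace ℝ (Fin 3) => 4 * π * ‖ξ - y‖ ^ 3 :=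
    continuous_const.mul ((continuous_const.sub continuous_id).norm.pow 3)
  exact hn.measurable.inv.mul (((continuous_const.sub h2).mul
    ((continuous_const.mul h0).add (continuous_const.mul h1))).measurable)

/-- **Pointwise domination of the scalar integrand**: with `|η| ≤ M`,
`|(4π|ξ−y|³)⁻¹ η(y)(ξ₂−y₂)(c₀y₀+c₁y₁)| ≤ (4π)⁻¹‖c‖(r(ξ)+1)(M·1_{|ξ−y|<1}|ξ−y|⁻² + |η(y)|)` — near `ξ`
from `|ξ₂ − y₂| ≤ |ξ − y|`, `r(y) ≤ r(ξ) + |ξ − y|`, `|η| ≤ M`; far from `ξ` from `|ξ − y| ≥ 1`.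
[folklore] -/
private theorem abs_radialIntegrand_le (hM : ∀ y, |η y| ≤ M) (c ξ y : EuclideanSpace ℝ (Fin 3)) :
    |(4 * π * ‖ξ - y‖ ^ 3)⁻¹ * η y * (ξ 2 - y 2) * (c 0 * y 0 + c 1 * y 1)| ≤
      (4 * π)⁻¹ * ‖c‖ * (cylRadius ξ + 1) * (M * kernelMajorant 1 (ξ - y) + |η y|) := by
  have hMnn : 0 ≤ M := (abs_nonneg _).trans (hM 0)
  have hk0 : 0 ≤ kernelMajorant 1 (ξ - y) := kernelMajorant_nonneg _ _
  have hrξ : 0 ≤ cylRadius ξ := cylRadius_nonneg ξ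
  have hRHS : 0 ≤ (4 * π)⁻¹ * ‖c‖ * (cylRadius ξ + 1) * (M * kernelMajorant 1 (ξ - y) + |η y|) := by
    positivity
  set a : ℝ := ‖ξ - y‖ with ha
  rcases (norm_nonneg (ξ - y)).eq_or_lt with ha0 | ha0
  · -- `y = ξ`: the integrand vanishes (junk value `0⁻¹ = 0`)
    have ha00 : a = 0 := by rw [ha, ← ha0]
    rw [ha00]
    simpa using hRHS
  have hsa : |ξ 2 - y 2| ≤ a := by
    have := abs_coord_le_norm_r3 (ξ - y) 2
    simpa only [PiLp.sub_apply] using this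
  have hpair := abs_horizontal_pairing_le_norm_mul_cylRadius c y
  have hry : cylRadius y ≤ cylRadius ξ + a := cylRadius_le_cylRadius_add_norm_sub' ξ y
  -- `|integrand| ≤ (4π)⁻¹ ‖c‖ |η| (r(ξ) + a) / a²`
  have h1 : |(4 * π * a ^ 3)⁻¹ * η y * (ξ 2 - y 2) * (c 0 * y 0 + c 1 * y 1)| ≤
      (4 * π)⁻¹ * ‖c‖ * |η y| * ((cylRadius ξ + a) * (a ^ 2)⁻¹) := by
    rw [abs_mul, abs_mul, abs_mul, abs_inv, abs_of_pos (by positivity : 0 < 4 * π * a ^ 3)]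
    calc (4 * π * a ^ 3)⁻¹ * |η y| * |ξ 2 - y 2| * |c 0 * y 0 + c 1 * y 1|
        ≤ (4 * π * a ^ 3)⁻¹ * |η y| * a * (‖c‖ * (cylRadius ξ + a)) := by
          gcongr
          exact hpair.trans (mul_le_mul_of_nonneg_left hry (norm_nonneg _))
      _ = (4 * π)⁻¹ * ‖c‖ * |η y| * ((cylRadius ξ + a) * (a ^ 2)⁻¹) := by
          field_simp
  refine h1.trans ?_
  by_cases hlt : a < 1
  · -- near: `a⁻² = 1_{|ξ−y|<1}|ξ−y|⁻²`, `|η| ≤ M`, `r(ξ) + a ≤ r(ξ) + 1`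
    have hk : kernelMajorant 1 (ξ - y) = (a ^ 2)⁻¹ := by
      have hmem : ξ - y ∈ ball (0 : EuclideanSpace ℝ (Fin 3)) 1 := by
        rw [mem_ball_zero_iff]; exact hlt
      simp [kernelMajorant, indicator_of_mem hmem, ha]
    calc (4 * π)⁻¹ * ‖c‖ * |η y| * ((cylRadius ξ + a) * (a ^ 2)⁻¹)
        ≤ (4 * π)⁻¹ * ‖c‖ * M * ((cylRadius ξ + 1) * (a ^ 2)⁻¹) := by
          gcongr
          exact hM y
      _ = (4 * π)⁻¹ * ‖c‖ * (cylRadius ξ + 1) * (M * kernelMajorant 1 (ξ - y)) := by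
          rw [hk]; ring
      _ ≤ (4 * π)⁻¹ * ‖c‖ * (cylRadius ξ + 1) * (M * kernelMajorant 1 (ξ - y) + |η y|) := by
          gcongr
          exact le_add_of_nonneg_right (abs_nonneg _)
  · -- far: `(r(ξ) + a)/a² ≤ r(ξ) + 1`
    have h1a : 1 ≤ a := not_lt.1 hlt
    have hq : (cylRadius ξ + a) * (a ^ 2)⁻¹ ≤ cylRadius ξ + 1 := by
      rw [← div_eq_mul_inv, div_le_iff₀ (by positivity)]
      nlinarith [mul_nonneg hrξ (by nlinarith : (0:ℝ) ≤ a ^ 2 - 1)]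
    calc (4 * π)⁻¹ * ‖c‖ * |η y| * ((cylRadius ξ + a) * (a ^ 2)⁻¹)
        ≤ (4 * π)⁻¹ * ‖c‖ * |η y| * (cylRadius ξ + 1) := by gcongr
      _ = (4 * π)⁻¹ * ‖c‖ * (cylRadius ξ + 1) * |η y| := by ring
      _ ≤ (4 * π)⁻¹ * ‖c‖ * (cylRadius ξ + 1) * (M * kernelMajorant 1 (ξ - y) + |η y|) := by
          gcongr
          exact le_add_of_nonneg_left (mul_nonneg hMnn hk0)

/-- **Integrability of the scalar integrand** for `η ∈ L¹ ∩ L^∞`: dominated by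
`(4π)⁻¹‖c‖(r(ξ)+1)(M·1_{|z|<1}|z|⁻²(ξ − ·) + |η|)`, the first summand integrable because `|z|⁻²`
is locally integrable in `ℝ³` (`integrable_kernelMajorant`). [folklore] -/
private theorem integrable_radialIntegrand (hη : Integrable η) (hM : ∀ y, |η y| ≤ M)
    (c ξ : EuclideanSpace ℝ (Fin 3)) :
    Integrable fun y : EuclideanSpace ℝ (Fin 3) =>
      (4 * π * ‖ξ - y‖ ^ 3)⁻¹ * η y * (ξ 2 - y 2) * (c 0 * y 0 + c 1 * y 1) := by
  have hdom : Integrable fun y : EuclideanSpace ℝ (Fin 3) =>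
      (4 * π)⁻¹ * ‖c‖ * (cylRadius ξ + 1) * (M * kernelMajorant 1 (ξ - y) + |η y|) :=
    ((((integrable_kernelMajorant 1).comp_sub_left ξ).const_mul M).add hη.abs).const_mul _
  refine hdom.mono' ?_ (Eventually.of_forall fun y => ?_)
  · have heq : (fun y : EuclideanSpace ℝ (Fin 3) =>
        (4 * π * ‖ξ - y‖ ^ 3)⁻¹ * η y * (ξ 2 - y 2) * (c 0 * y 0 + c 1 * y 1)) =
        fun y => (4 * π * ‖ξ - y‖ ^ 3)⁻¹ * ((ξ 2 - y 2) * (c 0 * y 0 + c 1 * y 1)) * η y := by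
      funext y; ring
    rw [heq]
    exact (measurable_radialKernelFactor c ξ).aestronglyMeasurable.mul hη.aestronglyMeasurable
  · rw [Real.norm_eq_abs]
    exact abs_radialIntegrand_le hM c ξ y

/-- **`∫ |η(y)| |ξ − y|⁻² dy ≤ 4πMR + R⁻² ∫|η|`** for every `R > 0` and `|η| ≤ M` (in `ℝ≥0∞`):
split `|z|⁻² ≤ 1_{|z|<R}|z|⁻² + R⁻²` (`norm_sub_sq_inv_le_kernelMajorant_add`), use `|η| ≤ M` and
`∫_{|z|<R}|z|⁻² = 4πR` (`lintegral_kernelMajorant`) near, `∫|η|` far. [folklore] -/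
private theorem lintegral_enorm_mul_inv_norm_sq_le_of_scale (hη : Integrable η) (hM : ∀ y, |η y| ≤ M)
    (ξ : EuclideanSpace ℝ (Fin 3)) {R : ℝ} (hR : 0 < R) :
    ∫⁻ y, ‖η y‖ₑ * ENNReal.ofReal ((‖ξ - y‖ ^ 2)⁻¹) ≤
      ENNReal.ofReal (M * (4 * π * R) + (R ^ 2)⁻¹ * ∫ y, |η y|) := by
  have hMnn : 0 ≤ M := (abs_nonneg _).trans (hM 0)
  have hA0 : 0 ≤ ∫ y, |η y| := integral_nonneg fun _ => abs_nonneg _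
  have hsplit : ∀ y, (‖ξ - y‖ ^ 2)⁻¹ ≤ kernelMajorant R (ξ - y) + (R ^ 2)⁻¹ := by
    intro y
    have h := norm_sub_sq_inv_le_kernelMajorant_add (R := R / 4) (by positivity) ξ y
    have e1 : 4 * (R / 4) = R := by ring
    have e2 : (16 * (R / 4) ^ 2)⁻¹ = (R ^ 2)⁻¹ := by congr 1; ring
    rwa [e1, e2] at h
  have hηe : ∀ y, ‖η y‖ₑ = ENNReal.ofReal |η y| := fun y => by
    rw [← ofReal_norm, Real.norm_eq_abs]
  have hpt : ∀ y, ‖η y‖ₑ * ENNReal.ofReal ((‖ξ - y‖ ^ 2)⁻¹) ≤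
      ENNReal.ofReal M * ENNReal.ofReal (kernelMajorant R (ξ - y)) +
        ENNReal.ofReal ((R ^ 2)⁻¹) * ‖η y‖ₑ := by
    intro y
    calc ‖η y‖ₑ * ENNReal.ofReal ((‖ξ - y‖ ^ 2)⁻¹)
        ≤ ‖η y‖ₑ * (ENNReal.ofReal (kernelMajorant R (ξ - y)) + ENNReal.ofReal ((R ^ 2)⁻¹)) := by
          rw [← ENNReal.ofReal_add (kernelMajorant_nonneg _ _) (by positivity)]
          exact mul_le_mul' le_rfl (ENNReal.ofReal_le_ofReal (hsplit y))
      _ = ‖η y‖ₑ * ENNReal.ofReal (kernelMajorant R (ξ - y)) +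
            ENNReal.ofReal ((R ^ 2)⁻¹) * ‖η y‖ₑ := by rw [mul_add, mul_comm (‖η y‖ₑ) (ENNReal.ofReal ((R ^ 2)⁻¹))]
      _ ≤ ENNReal.ofReal M * ENNReal.ofReal (kernelMajorant R (ξ - y)) +
            ENNReal.ofReal ((R ^ 2)⁻¹) * ‖η y‖ₑ := by
          gcongr
          rw [hηe]
          exact ENNReal.ofReal_le_ofReal (hM y)
  have hmk : Measurable fun y : EuclideanSpace ℝ (Fin 3) =>
      ENNReal.ofReal (kernelMajorant R (ξ - y)) :=
    ((measurable_kernelMajorant R).comp (measurable_const.sub measurable_id)).ennreal_ofReal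
  have hA : ∫⁻ y, ‖η y‖ₑ = ENNReal.ofReal (∫ y, |η y|) := by
    rw [← ofReal_integral_norm_eq_lintegral_enorm hη]
    simp only [Real.norm_eq_abs]
  calc ∫⁻ y, ‖η y‖ₑ * ENNReal.ofReal ((‖ξ - y‖ ^ 2)⁻¹)
      ≤ ∫⁻ y, (ENNReal.ofReal M * ENNReal.ofReal (kernelMajorant R (ξ - y)) +
          ENNReal.ofReal ((R ^ 2)⁻¹) * ‖η y‖ₑ) := lintegral_mono hpt
    _ = ENNReal.ofReal M * (∫⁻ y, ENNReal.ofReal (kernelMajorant R (ξ - y))) +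
          ENNReal.ofReal ((R ^ 2)⁻¹) * ∫⁻ y, ‖η y‖ₑ := by
        rw [lintegral_add_left (hmk.const_mul _), lintegral_const_mul _ hmk,
          lintegral_const_mul' _ _ ENNReal.ofReal_ne_top]
    _ = ENNReal.ofReal M * ENNReal.ofReal (4 * π * R) +
          ENNReal.ofReal ((R ^ 2)⁻¹) * ENNReal.ofReal (∫ y, |η y|) := by
        rw [lintegral_sub_left_eq_self (μ := (volume : Measure (EuclideanSpace ℝ (Fin 3))))
          (fun z => ENNReal.ofReal (kernelMajorant R z)) ξ, lintegral_kernelMajorant hR.le, hA]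
    _ = ENNReal.ofReal (M * (4 * π * R) + (R ^ 2)⁻¹ * ∫ y, |η y|) := by
        rw [← ENNReal.ofReal_mul hMnn, ← ENNReal.ofReal_mul (by positivity),
          ← ENNReal.ofReal_add (by positivity) (by positivity)]

end Estimates

/-! ### Assembly: the horizontal velocity of an azimuthal axisymmetric vorticity field -/

section Assembly

variable {η : EuclideanSpace ℝ (Fin 3) → ℝ} {M : ℝ} {c : EuclideanSpace ℝ (Fin 3)}

/-- **The bound at scale `R`.** Let `η : ℝ³ → ℝ` be an integrable axisymmetric scalar with
`|η| ≤ M`, `w(y) = η(y) · J y` the associated azimuthal field (`J y = (−y₁, y₀, 0) = r e_θ`, so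
`w = ω_θ e_θ` with `ω_θ/r = η`), and `u = K₃ ∗ w` its Biot–Savart velocity. Then for every horizontal
covector `c` (`c₂ = 0`), every `x` and every `R > 0`:
`|⟪c, u(x)⟫| ≤ ‖c‖ · r(x) · (4MR + (πR²)⁻¹ ∫|η|)`.
Proof: `⟪c, u(x)⟫ = ∫ (4π|x−y|³)⁻¹ η(y)(x₂−y₂)(c₀y₀+c₁y₁) dy`; the same integral at the axis point
`x' = (0,0,x₂)` vanishes (`integral_radialIntegrand_axis_eq_zero`); the difference of the integrands is
`≤ (4π)⁻¹‖c‖ 2r(x) |η(y)| (|x−y|⁻² + |x'−y|⁻²)` (`abs_radialIntegrand_sub_axis_le`), and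
`∫|η||ξ−y|⁻² ≤ 4πMR + R⁻²∫|η|` for `ξ = x, x'`. This is (2.15) before optimisation in `R`
(the paper's `C R ‖ω_θ/r‖_∞ + C R⁻² ‖ω_θ‖_{L¹}`, p. 9, "Optimizing over `R > 0` gives the bound").
[cite: GallaySverak2016, Prop. 2.6 (2.15), proof p. 9 (arXiv)] -/
theorem abs_inner_biotSavart_smul_rotGen_le_of_scale (hη : Integrable η)
    (hax : IsAxisymmetricScalar η) (hM : ∀ y, |η y| ≤ M) (hc : c 2 = 0)
    (x : EuclideanSpace ℝ (Fin 3)) {R : ℝ} (hR : 0 < R) :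
    |⟪c, biotSavart (fun y => η y • rotGen y) x⟫| ≤
      ‖c‖ * cylRadius x * (4 * M * R + (π * R ^ 2)⁻¹ * ∫ y, |η y|) := by
  have hMnn : 0 ≤ M := (abs_nonneg _).trans (hM 0)
  have hA0 : 0 ≤ ∫ y, |η y| := integral_nonneg fun _ => abs_nonneg _
  have hr : 0 ≤ cylRadius x := cylRadius_nonneg x
  have hRHS : 0 ≤ ‖c‖ * cylRadius x * (4 * M * R + (π * R ^ 2)⁻¹ * ∫ y, |η y|) := by positivity
  by_cases hint : Integrable (fun y => biotSavartKernel (x - y) (η y • rotGen y))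
  swap
  · rw [biotSavart, integral_undef hint, inner_zero_right, abs_zero]
    exact hRHS
  -- the axis point below `x`
  set x' : EuclideanSpace ℝ (Fin 3) := EuclideanSpace.single 2 (x 2) with hx'
  have hx'0 : x' 0 = 0 := by simp [hx']
  have hx'1 : x' 1 = 0 := by simp [hx']
  -- the scalar integrand
  set Φ : EuclideanSpace ℝ (Fin 3) → EuclideanSpace ℝ (Fin 3) → ℝ := fun ξ y =>
    (4 * π * ‖ξ - y‖ ^ 3)⁻¹ * η y * (ξ 2 - y 2) * (c 0 * y 0 + c 1 * y 1) with hΦ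
  have h1 : ⟪c, biotSavart (fun y => η y • rotGen y) x⟫ = ∫ y, Φ x y := by
    rw [biotSavart, ← integral_inner hint]
    exact integral_congr_ae (Eventually.of_forall fun y =>
      inner_biotSavartKernel_smul_rotGen hc (η y) x y)
  have h2 : ∫ y, Φ x' y = 0 := integral_radialIntegrand_axis_eq_zero hax hx'0 hx'1
  have hix : Integrable (Φ x) := integrable_radialIntegrand hη hM c x
  have hix' : Integrable (Φ x') := integrable_radialIntegrand hη hM c x'
  have h3 : ∫ y, Φ x y = ∫ y, (Φ x y - Φ x' y) := by
    rw [integral_sub hix hix', h2, sub_zero]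
  -- the pointwise bound in `ℝ≥0∞`
  set K : ℝ := (4 * π)⁻¹ * ‖c‖ * (2 * cylRadius x) with hK
  have hK0 : 0 ≤ K := by positivity
  have hηe : ∀ y, ‖η y‖ₑ = ENNReal.ofReal |η y| := fun y => by
    rw [← ofReal_norm, Real.norm_eq_abs]
  have hpt : ∀ y, ‖Φ x y - Φ x' y‖ₑ ≤ ENNReal.ofReal K *
      (‖η y‖ₑ * ENNReal.ofReal ((‖x - y‖ ^ 2)⁻¹) +
        ‖η y‖ₑ * ENNReal.ofReal ((‖x' - y‖ ^ 2)⁻¹)) := by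
    intro y
    have h := abs_radialIntegrand_sub_axis_le η c x y
    rw [← hx', ← hK] at h
    rw [← ofReal_norm, Real.norm_eq_abs, hηe, ← mul_add, ← ENNReal.ofReal_add (by positivity)
      (by positivity), ← ENNReal.ofReal_mul (abs_nonneg _), ← ENNReal.ofReal_mul hK0]
    refine ENNReal.ofReal_le_ofReal ?_
    simpa [hΦ, mul_assoc] using h
  have hB := lintegral_enorm_mul_inv_norm_sq_le_of_scale hη hM x hR
  have hB' := lintegral_enorm_mul_inv_norm_sq_le_of_scale hη hM x' hR
  set B : ℝ := M * (4 * π * R) + (R ^ 2)⁻¹ * ∫ y, |η y| with hBdef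
  have hB0 : 0 ≤ B := by positivity
  have hmeas : ∀ ξ : EuclideanSpace ℝ (Fin 3), AEMeasurable fun y =>
      ‖η y‖ₑ * ENNReal.ofReal ((‖ξ - y‖ ^ 2)⁻¹) := fun ξ =>
    hη.aestronglyMeasurable.enorm.mul
      ((continuous_const.sub continuous_id).norm.pow 2).measurable.inv.ennreal_ofReal.aemeasurable
  have h4 : ‖∫ y, (Φ x y - Φ x' y)‖ₑ ≤ ENNReal.ofReal (K * (B + B)) := by
    calc ‖∫ y, (Φ x y - Φ x' y)‖ₑ ≤ ∫⁻ y, ‖Φ x y - Φ x' y‖ₑ := enorm_integral_le_lintegral_enorm _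
      _ ≤ ∫⁻ y, ENNReal.ofReal K * (‖η y‖ₑ * ENNReal.ofReal ((‖x - y‖ ^ 2)⁻¹) +
            ‖η y‖ₑ * ENNReal.ofReal ((‖x' - y‖ ^ 2)⁻¹)) := lintegral_mono hpt
      _ = ENNReal.ofReal K * ((∫⁻ y, ‖η y‖ₑ * ENNReal.ofReal ((‖x - y‖ ^ 2)⁻¹)) +
            ∫⁻ y, ‖η y‖ₑ * ENNReal.ofReal ((‖x' - y‖ ^ 2)⁻¹)) := by
          rw [lintegral_const_mul' _ _ ENNReal.ofReal_ne_top, lintegral_add_left' (hmeas x)]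
      _ ≤ ENNReal.ofReal K * (ENNReal.ofReal B + ENNReal.ofReal B) := by gcongr
      _ = ENNReal.ofReal (K * (B + B)) := by
          rw [← ENNReal.ofReal_add hB0 hB0, ← ENNReal.ofReal_mul hK0]
  -- back to `ℝ`
  rw [h1, h3]
  have h5 : ‖∫ y, (Φ x y - Φ x' y)‖ ≤ K * (B + B) := by
    rw [← ofReal_norm] at h4
    exact (ENNReal.ofReal_le_ofReal_iff (by positivity)).1 h4
  rw [Real.norm_eq_abs] at h5
  refine h5.trans (le_of_eq ?_)
  rw [hK, hBdef]
  field_simp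
  ring

/-- **Gallay–Šverák 2015, Prop. 2.6 (2.15), three-dimensional form with an explicit constant.**
For an integrable axisymmetric scalar `η` with `|η| ≤ M` and the azimuthal field `w = η · J`
(`ω_θ e_θ` with `ω_θ/r = η`), the Biot–Savart velocity `u = K₃ ∗ w` satisfies, for every horizontal
covector `c` and every `x`,
`|⟪c, u(x)⟫| ≤ (9/2) ‖c‖ (∫|η| · M²)^{1/3} r(x)`;
i.e. the horizontal (= radial, `u` being poloidal) velocity is bounded by
`(9/2) ‖ω_θ/r‖_{L¹(ℝ³)}^{1/3} ‖ω_θ/r‖_{L^∞}^{2/3} · r`. In the units of the paper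
(`‖ω_θ/r‖_{L¹(ℝ³)} = ∫|η| dx = 2π‖ω_θ‖_{L¹(Ω)}`) this is (2.15),
"`‖u_r/r‖_{L^∞(Ω)} ≤ C ‖ω_θ‖_{L¹(Ω)}^{1/3} ‖ω_θ/r‖_{L^∞(Ω)}^{2/3}`", with `C = (9/2)(2π)^{1/3}`. From
the scale form with `R = (∫|η|/M)^{1/3}` (`4 + 1/π ≤ 9/2`); the degenerate cases `M = 0`
(`w = 0`) and `∫|η| = 0` (`w = 0` a.e.) give `u(x) = 0`. Not the paper's proof (which estimates
the axisymmetric kernel `G_r` of (2.11) through `F'`, p. 8–9); cf. its Remark 2.7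
(`‖u_r/r‖_∞ ≤ C‖ω_θ/r‖_{L^{3,1}}`, Abidi–Hmidi–Keraani). [cite: GallaySverak2016, Prop. 2.6 (2.15) (arXiv p. 8)] -/
theorem abs_inner_biotSavart_smul_rotGen_le (hη : Integrable η) (hax : IsAxisymmetricScalar η)
    (hM : ∀ y, |η y| ≤ M) (hc : c 2 = 0) (x : EuclideanSpace ℝ (Fin 3)) :
    |⟪c, biotSavart (fun y => η y • rotGen y) x⟫| ≤
      9 / 2 * ‖c‖ * ((∫ y, |η y|) * M ^ 2) ^ (1 / 3 : ℝ) * cylRadius x := by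
  have hMnn : 0 ≤ M := (abs_nonneg _).trans (hM 0)
  have hA0 : 0 ≤ ∫ y, |η y| := integral_nonneg fun _ => abs_nonneg _
  have hr : 0 ≤ cylRadius x := cylRadius_nonneg x
  set A : ℝ := ∫ y, |η y| with hA
  set T : ℝ := (A * M ^ 2) ^ (1 / 3 : ℝ) with hT
  have hT0 : 0 ≤ T := Real.rpow_nonneg (by positivity) _
  have hRHS : 0 ≤ 9 / 2 * ‖c‖ * T * cylRadius x := by positivity
  -- degenerate case `M = 0`: `η = 0`, `w = 0`, `u = 0`
  rcases hMnn.eq_or_lt with hM0 | hMpos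
  · have hw : (fun y => η y • rotGen y) = 0 := by
      funext y
      have : η y = 0 := abs_nonpos_iff.1 (hM0 ▸ hM y)
      simp [this]
    rw [hw, biotSavart_zero]
    simpa using hRHS
  -- degenerate case `∫|η| = 0`: `η = 0` a.e., `u(x) = 0`
  rcases hA0.eq_or_lt with hA00 | hApos
  · have hae : (fun y => |η y|) =ᵐ[volume] 0 :=
      (integral_eq_zero_iff_of_nonneg (fun y => abs_nonneg (η y)) hη.abs).1 hA00.symm
    have hzero : biotSavart (fun y => η y • rotGen y) x = 0 := by
      rw [biotSavart]
      refine integral_eq_zero_of_ae (hae.mono fun y hy => ?_)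
      have hy' : η y = 0 := by simpa using hy
      simp [hy']
    rw [hzero]
    simpa using hRHS
  -- main case: `R = T/M`, `MR = T`, `A/R² = T`
  have hT3 : T ^ 3 = A * M ^ 2 := by
    rw [hT, one_div]
    exact Real.rpow_inv_natCast_pow (by positivity) (by norm_num)
  have hTpos : 0 < T := Real.rpow_pos_of_pos (by positivity) _
  have hR : 0 < T / M := div_pos hTpos hMpos
  have h := abs_inner_biotSavart_smul_rotGen_le_of_scale hη hax hM hc x hR
  have hA' : A = T ^ 3 / M ^ 2 := by
    rw [hT3]; field_simp
  have e1 : 4 * M * (T / M) + (π * (T / M) ^ 2)⁻¹ * A = (4 + π⁻¹) * T := by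
    rw [hA']
    field_simp
  rw [e1] at h
  refine h.trans ?_
  have hπ : (4 + π⁻¹) ≤ 9 / 2 := by
    have : π⁻¹ ≤ 1 / 2 := by
      rw [inv_eq_one_div]
      exact one_div_le_one_div_of_le (by norm_num) (by linarith [Real.pi_gt_three])
    linarith
  calc ‖c‖ * cylRadius x * ((4 + π⁻¹) * T) = (4 + π⁻¹) * (‖c‖ * T * cylRadius x) := by ring
    _ ≤ 9 / 2 * (‖c‖ * T * cylRadius x) := by gcongr
    _ = 9 / 2 * ‖c‖ * T * cylRadius x := by ring

/-- **Components**: under the hypotheses of `abs_inner_biotSavart_smul_rotGen_le`, each horizontal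
component of the Biot–Savart velocity obeys `|u_i(x)| ≤ (9/2)(∫|η| · M²)^{1/3} r(x)`, `i = 0, 1`
(take `c = e_i`). In particular the horizontal velocity of an azimuthal axisymmetric vorticity
field vanishes on the axis, linearly in the distance to it. [cite: GallaySverak2016, Prop. 2.6 (2.15) (arXiv p. 8)] -/
theorem abs_biotSavart_smul_rotGen_apply_le (hη : Integrable η) (hax : IsAxisymmetricScalar η)
    (hM : ∀ y, |η y| ≤ M) (x : EuclideanSpace ℝ (Fin 3)) {i : Fin 3} (hi : i ≠ 2) :
    |biotSavart (fun y => η y • rotGen y) x i| ≤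
      9 / 2 * ((∫ y, |η y|) * M ^ 2) ^ (1 / 3 : ℝ) * cylRadius x := by
  have hc : (EuclideanSpace.single i (1 : ℝ) : EuclideanSpace ℝ (Fin 3)) 2 = 0 := by
    simp [hi.symm]
  have h := abs_inner_biotSavart_smul_rotGen_le hη hax hM hc x
  rw [EuclideanSpace.inner_single_left] at h
  simpa [PiLp.norm_single] using h

/-- **The radial momentum**: `|x₀u₀(x) + x₁u₁(x)| ≤ (9/2)(∫|η| · M²)^{1/3} r(x)²` (take
`c = (x₀, x₁, 0)`, `‖c‖ = r(x)`), i.e. `|u_r| ≤ (9/2)(∫|η| M²)^{1/3} r` — the paper's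
`‖u_r/r‖_∞ ≤ C‖ω_θ‖_{L¹(Ω)}^{1/3}‖ω_θ/r‖_∞^{2/3}`. [cite: GallaySverak2016, Prop. 2.6 (2.15) (arXiv p. 8)] -/
theorem abs_horizontal_inner_biotSavart_smul_rotGen_le (hη : Integrable η)
    (hax : IsAxisymmetricScalar η) (hM : ∀ y, |η y| ≤ M) (x : EuclideanSpace ℝ (Fin 3)) :
    |x 0 * biotSavart (fun y => η y • rotGen y) x 0 + x 1 * biotSavart (fun y => η y • rotGen y) x 1| ≤
      9 / 2 * ((∫ y, |η y|) * M ^ 2) ^ (1 / 3 : ℝ) * cylRadius x ^ 2 := by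
  set c : EuclideanSpace ℝ (Fin 3) := WithLp.toLp 2 ![x 0, x 1, 0] with hcdef
  have hc : c 2 = 0 := by simp [hcdef]
  have hcn : ‖c‖ = cylRadius x := by
    rw [cylRadius, EuclideanSpace.norm_eq]
    congr 1
    simp [hcdef, Fin.sum_univ_three]
  have h := abs_inner_biotSavart_smul_rotGen_le hη hax hM hc x
  rw [real_inner_fin3', hcn] at h
  have e : c 0 * biotSavart (fun y => η y • rotGen y) x 0 + c 1 * biotSavart (fun y => η y • rotGen y) x 1 +
      c 2 * biotSavart (fun y => η y • rotGen y) x 2 =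
      x 0 * biotSavart (fun y => η y • rotGen y) x 0 + x 1 * biotSavart (fun y => η y • rotGen y) x 1 := by
    simp [hcdef]
  rw [e] at h
  refine h.trans (le_of_eq ?_)
  ring

/-- **The horizontal speed**: `√(u₀(x)² + u₁(x)²) ≤ (9/2)(∫|η| · M²)^{1/3} r(x)` (take `c = u_h(x)`
itself: `⟪u_h, u⟫ = ‖u_h‖²`). For the poloidal field `u` this is `|u_r(x)| ≤ (9/2)(∫|η| M²)^{1/3} r(x)`.
[cite: GallaySverak2016, Prop. 2.6 (2.15) (arXiv p. 8)] -/
theorem sqrt_sq_add_sq_biotSavart_smul_rotGen_le (hη : Integrable η)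
    (hax : IsAxisymmetricScalar η) (hM : ∀ y, |η y| ≤ M) (x : EuclideanSpace ℝ (Fin 3)) :
    Real.sqrt (biotSavart (fun y => η y • rotGen y) x 0 ^ 2 +
        biotSavart (fun y => η y • rotGen y) x 1 ^ 2) ≤
      9 / 2 * ((∫ y, |η y|) * M ^ 2) ^ (1 / 3 : ℝ) * cylRadius x := by
  set u : EuclideanSpace ℝ (Fin 3) := biotSavart (fun y => η y • rotGen y) x with hu
  set c : EuclideanSpace ℝ (Fin 3) := WithLp.toLp 2 ![u 0, u 1, 0] with hcdef
  have hc : c 2 = 0 := by simp [hcdef]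
  have hcn : ‖c‖ = Real.sqrt (u 0 ^ 2 + u 1 ^ 2) := by
    rw [EuclideanSpace.norm_eq]
    congr 1
    simp [hcdef, Fin.sum_univ_three]
  have hMnn : 0 ≤ M := (abs_nonneg _).trans (hM 0)
  have hA0 : 0 ≤ ∫ y, |η y| := integral_nonneg fun _ => abs_nonneg _
  set T : ℝ := ((∫ y, |η y|) * M ^ 2) ^ (1 / 3 : ℝ) with hT
  have hT0 : 0 ≤ T := Real.rpow_nonneg (by positivity) _
  have hr : 0 ≤ cylRadius x := cylRadius_nonneg x
  have h := abs_inner_biotSavart_smul_rotGen_le hη hax hM hc x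
  rw [← hu, real_inner_fin3'] at h
  have e : c 0 * u 0 + c 1 * u 1 + c 2 * u 2 = ‖c‖ ^ 2 := by
    rw [hcn, Real.sq_sqrt (by positivity)]
    simp [hcdef]
    ring
  rw [e, abs_of_nonneg (sq_nonneg _)] at h
  -- `‖c‖² ≤ (9/2)‖c‖ T r ⇒ ‖c‖ ≤ (9/2) T r`
  rw [← hcn]
  rcases (norm_nonneg c).eq_or_lt with h0 | hpos
  · rw [← h0]; positivity
  · have h' : ‖c‖ * ‖c‖ ≤ (9 / 2 * T * cylRadius x) * ‖c‖ := by
      calc ‖c‖ * ‖c‖ = ‖c‖ ^ 2 := (sq _).symm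
        _ ≤ 9 / 2 * ‖c‖ * T * cylRadius x := h
        _ = (9 / 2 * T * cylRadius x) * ‖c‖ := by ring
    exact le_of_mul_le_mul_right h' hpos

/-- **The radial velocity** `u_r = ⟪u, e_r⟫` (`radialVelocity`, junk `0` on the axis):
`|u_r(x)| ≤ (9/2)(∫|η| · M²)^{1/3} r(x)`, i.e. `|u_r/r| ≤ (9/2)(∫|η| M²)^{1/3}` off the axis —
Gallay–Šverák's (2.15) for the Biot–Savart velocity of `ω_θ e_θ`, `η = ω_θ/r`. [cite: GallaySverak2016, Prop. 2.6 (2.15) (arXiv p. 8)] -/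
theorem abs_radialVelocity_biotSavart_smul_rotGen_le (hη : Integrable η)
    (hax : IsAxisymmetricScalar η) (hM : ∀ y, |η y| ≤ M) (x : EuclideanSpace ℝ (Fin 3)) :
    |radialVelocity (biotSavart (fun y => η y • rotGen y)) x| ≤
      9 / 2 * ((∫ y, |η y|) * M ^ 2) ^ (1 / 3 : ℝ) * cylRadius x := by
  have hMnn : 0 ≤ M := (abs_nonneg _).trans (hM 0)
  have hA0 : 0 ≤ ∫ y, |η y| := integral_nonneg fun _ => abs_nonneg _
  set u : EuclideanSpace ℝ (Fin 3) := biotSavart (fun y => η y • rotGen y) x with hu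
  have hrv : radialVelocity (biotSavart (fun y => η y • rotGen y)) x =
      (cylRadius x)⁻¹ * (x 0 * u 0 + x 1 * u 1) := by
    rw [radialVelocity, real_inner_fin3', ← hu]
    simp only [eR, PiLp.smul_apply, smul_eq_mul, Matrix.cons_val_zero,
      Matrix.cons_val_one, Matrix.cons_val_two, Matrix.head_cons, Matrix.tail_cons]
    ring
  rw [hrv]
  rcases (cylRadius_nonneg x).eq_or_lt with h0 | hpos
  · rw [← h0]; simp
  · have h := abs_horizontal_inner_biotSavart_smul_rotGen_le hη hax hM x
    rw [← hu] at h
    rw [abs_mul, abs_inv, abs_of_pos hpos, inv_mul_le_iff₀ hpos]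
    refine h.trans (le_of_eq ?_)
    ring

end Assembly

/-! ### Application: the vorticity of an axisymmetric swirl-free field, and Tao-class flows -/

section Curl

variable {v : EuclideanSpace ℝ (Fin 3) → EuclideanSpace ℝ (Fin 3)}

/-- **Dictionary**: the vorticity of an axisymmetric swirl-free `v ∈ C³` is the azimuthal field
`curl v = (ω_θ/r) · J`, `ω_θ/r = angVortQuot v`, `J y = (−y₁, y₀, 0)` (`curl_eq_hadamardQuotFst_smul_rotGen`
and `angVortQuot_eq_hadamardQuotFst_curl`; Gallay–Šverák (1.3), (1.6): `ω = ω_θ e_θ`, `η = ω_θ/r`).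
[cite: GallaySverak2016, §1 (1.3) and (1.6) (arXiv pp. 2–3)] -/
theorem curl_eq_angVortQuot_smul_rotGen (hax : IsAxisymmetric v) (hsw : HasNoSwirl v)
    (hv : ContDiff ℝ 3 v) : curl v = fun y => angVortQuot v y • rotGen y := by
  funext y
  rw [angVortQuot_eq_hadamardQuotFst_curl hax hsw hv]
  exact curl_eq_hadamardQuotFst_smul_rotGen hax hsw (hv.of_le (by norm_num)) y

/-- A continuous function bounded off the axis is bounded everywhere. [folklore] -/
private theorem abs_le_of_abs_le_off_axis_of_continuous {f : EuclideanSpace ℝ (Fin 3) → ℝ} (hf : Continuous f)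
    {K : ℝ} (h : ∀ x, cylRadius x ≠ 0 → |f x| ≤ K) (x : EuclideanSpace ℝ (Fin 3)) : |f x| ≤ K := by
  by_cases hx : cylRadius x ≠ 0
  · exact h x hx
  push Not at hx
  -- approach `x` along `x + (n+1)⁻¹ e₀`
  set e : EuclideanSpace ℝ (Fin 3) := EuclideanSpace.single 0 1 with he
  have hlim : Tendsto (fun n : ℕ => x + (1 / ((n : ℝ) + 1)) • e) atTop (𝓝 x) := by
    have h1 := (tendsto_one_div_add_atTop_nhds_zero_nat (𝕜 := ℝ)).smul_const e
    rw [zero_smul] at h1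
    simpa using tendsto_const_nhds.add h1
  have hval : ∀ n : ℕ, |f (x + (1 / ((n : ℝ) + 1)) • e)| ≤ K := by
    intro n
    refine h _ ?_
    obtain ⟨hx0, -⟩ := (cylRadius_eq_zero_iff x).1 hx
    intro hr
    have h0 := ((cylRadius_eq_zero_iff _).1 hr).1
    simp [he, hx0] at h0
    exact Nat.cast_add_one_ne_zero n h0
  exact le_of_tendsto' ((continuous_abs.tendsto _).comp ((hf.tendsto x).comp hlim)) hval

/-- **Gallay–Šverák (2.15) for the vorticity of an axisymmetric swirl-free field** (kinematic): for
`v ∈ C³` axisymmetric without swirl with `η = ω_θ/r = angVortQuot v ∈ L¹(ℝ³)` and `|η| ≤ L`, the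
Biot–Savart velocity `K₃ ∗ (curl v)` has radial component
`|(K₃ ∗ curl v)_r(x)| ≤ (9/2) (∫|η| · L²)^{1/3} r(x)` and radial momentum
`|x₀(K₃∗curl v)₀ + x₁(K₃∗curl v)₁| ≤ (9/2)(∫|η| · L²)^{1/3} r(x)²`.
[cite: GallaySverak2016, Prop. 2.6 (2.15) (arXiv p. 8)] -/
theorem abs_radialVelocity_biotSavart_curl_le (hax : IsAxisymmetric v) (hsw : HasNoSwirl v)
    (hv : ContDiff ℝ 3 v) (hint : Integrable (angVortQuot v)) {L : ℝ}
    (hL : ∀ y, |angVortQuot v y| ≤ L) (x : EuclideanSpace ℝ (Fin 3)) :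
    |radialVelocity (biotSavart (curl v)) x| ≤
        9 / 2 * ((∫ y, |angVortQuot v y|) * L ^ 2) ^ (1 / 3 : ℝ) * cylRadius x ∧
      |x 0 * biotSavart (curl v) x 0 + x 1 * biotSavart (curl v) x 1| ≤
        9 / 2 * ((∫ y, |angVortQuot v y|) * L ^ 2) ^ (1 / 3 : ℝ) * cylRadius x ^ 2 := by
  have hax' : IsAxisymmetricScalar (angVortQuot v) := hax.isAxisymmetricScalar_angVortQuot hv
  rw [curl_eq_angVortQuot_smul_rotGen hax hsw hv]
  exact ⟨abs_radialVelocity_biotSavart_smul_rotGen_le hint hax' hL x,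
    abs_horizontal_inner_biotSavart_smul_rotGen_le hint hax' hL x⟩

end Curl

section Flow

variable {T ν : ℝ} {u₀ : EuclideanSpace ℝ (Fin 3) → EuclideanSpace ℝ (Fin 3)}
  {u : ℝ → EuclideanSpace ℝ (Fin 3) → EuclideanSpace ℝ (Fin 3)}
  {p : ℝ → EuclideanSpace ℝ (Fin 3) → ℝ}

/-- **Gallay–Šverák (2.15) along swirl-free axisymmetric flows.** For a Tao-class solution `(u, p)`
on `[0, T]` (`0 < T`, any viscosity `ν > 0`) from an axisymmetric swirl-free datum `u₀` with
`η₀ = ω_θ/r = angVortQuot u₀ ∈ L¹(ℝ³)` (`‖ω₀‖_{L¹(Ω)} = (2π)⁻¹∫|η₀|`), every `t ∈ [0, T]` and every bound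
`|η(t, ·)| ≤ L`: for all `x`,
`|u_r(t, x)| ≤ (9/2) (∫|η₀| · L²)^{1/3} r(x)` and `|x₀u₀ + x₁u₁|(t, x) ≤ (9/2)(∫|η₀| · L²)^{1/3} r(x)²`.
Ingredients (tree theorems): the slice is axisymmetric without swirl (`IsTaoSolutionOn.isAxisymmetric`,
`…hasNoSwirl`), `ω(t) = η(t) · J` (`curl_eq_angVortQuot_smul_rotGen`), `∫|η(t)| ≤ ∫|η₀|` (Lemma 5.1,
`lintegral_abs_angVortQuot_le_of_datum`), the slice IS the Biot–Savart velocity of its vorticity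
(`IsTaoSolutionOn.biotSavart_curl_eq_self`), and the kinematic bound
`abs_radialVelocity_biotSavart_smul_rotGen_le`. In the paper's units this is
`‖u_r(t)/r‖_∞ ≤ (9/2)(2π)^{1/3} ‖ω₀‖_{L¹(Ω)}^{1/3} ‖(ω_θ/r)(t)‖_∞^{2/3}`, the form used in the proof of
Prop. 5.3 (p. 17: "`‖u_r(t)/r‖_∞ ≤ C‖ω_θ(t)‖_{L¹}^{1/3}‖ω_θ(t)/r‖_∞^{2/3} ≤ CM/t`").
[cite: GallaySverak2016, Prop. 2.6 (2.15) (arXiv p. 8) with Lemma 5.1 (p. 16); used p. 17] -/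
theorem IsTaoSolutionOn.abs_radialVelocity_le_of_abs_angVortQuot_le (h : IsTaoSolutionOn T ν u₀ u p)
    (hT : 0 < T) (hν : 0 < ν) (h0 : IsAxisymmetric u₀) (h0' : HasNoSwirl u₀)
    (hL1 : Integrable (angVortQuot u₀)) {t : ℝ} (ht : t ∈ Icc 0 T) {L : ℝ}
    (hL : ∀ y, |angVortQuot (u t) y| ≤ L) (x : EuclideanSpace ℝ (Fin 3)) :
    |radialVelocity (u t) x| ≤
        9 / 2 * ((∫ y, |angVortQuot u₀ y|) * L ^ 2) ^ (1 / 3 : ℝ) * cylRadius x ∧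
      |x 0 * u t x 0 + x 1 * u t x 1| ≤
        9 / 2 * ((∫ y, |angVortQuot u₀ y|) * L ^ 2) ^ (1 / 3 : ℝ) * cylRadius x ^ 2 := by
  have h0T : (0 : ℝ) ∈ Icc 0 T := ⟨le_rfl, hT.le⟩
  have hax : IsAxisymmetric (u t) := h.isAxisymmetric hν hT h0 t ht
  have hsw : HasNoSwirl (u t) := h.hasNoSwirl hν hT h0 h0' t ht
  have hu3 : ContDiff ℝ 3 (u t) := (h.classical.contDiff_velocity ht).of_le (by norm_cast)
  have hηc : Continuous (angVortQuot (u t)) :=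
    (contDiff_angVortQuot (n := 0) (by exact_mod_cast hu3)).continuous
  -- `η(t) ∈ L¹` with `∫|η(t)| ≤ ∫|η₀|` (Lemma 5.1, tree)
  have hlin : ∫⁻ y, ‖angVortQuot (u t) y‖ₑ ≤ ∫⁻ y, ‖angVortQuot u₀ y‖ₑ := by
    have := h.lintegral_abs_angVortQuot_le_of_datum hT hν h0 h0' h0T ht ht.1
    rwa [h.initial] at this
  have hηint : Integrable (angVortQuot (u t)) :=
    ⟨hηc.aestronglyMeasurable, lt_of_le_of_lt hlin hL1.hasFiniteIntegral⟩
  have hA : ∫ y, |angVortQuot (u t) y| ≤ ∫ y, |angVortQuot u₀ y| := by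
    have e1 : ∫ y, |angVortQuot (u t) y| = (∫⁻ y, ‖angVortQuot (u t) y‖ₑ).toReal := by
      rw [← integral_norm_eq_lintegral_enorm hηc.aestronglyMeasurable]
      simp only [Real.norm_eq_abs]
    have e2 : ∫ y, |angVortQuot u₀ y| = (∫⁻ y, ‖angVortQuot u₀ y‖ₑ).toReal := by
      rw [← integral_norm_eq_lintegral_enorm hL1.aestronglyMeasurable]
      simp only [Real.norm_eq_abs]
    rw [e1, e2]
    exact ENNReal.toReal_mono hL1.hasFiniteIntegral.ne hlin
  have hA0 : 0 ≤ ∫ y, |angVortQuot (u t) y| := integral_nonneg fun _ => abs_nonneg _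
  -- the kinematic bound for `ω(t)`, and `u(t) = biotSavart ω(t)`
  have hkin := abs_radialVelocity_biotSavart_curl_le hax hsw hu3 hηint hL x
  rw [h.biotSavart_curl_eq_self ht] at hkin
  have hmono : ((∫ y, |angVortQuot (u t) y|) * L ^ 2) ^ (1 / 3 : ℝ) ≤
      ((∫ y, |angVortQuot u₀ y|) * L ^ 2) ^ (1 / 3 : ℝ) :=
    Real.rpow_le_rpow (by positivity) (mul_le_mul_of_nonneg_right hA (sq_nonneg L)) (by norm_num)
  have hr : 0 ≤ cylRadius x := cylRadius_nonneg x
  exact ⟨hkin.1.trans (by gcongr), hkin.2.trans (by gcongr)⟩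

/-- **The smooth quotient `u_r/r` along the flow**: under the hypotheses of
`IsTaoSolutionOn.abs_radialVelocity_le_of_abs_angVortQuot_le`, the smooth radial quotient
`radVelQuot (u t) = (x₀u₀ + x₁u₁)/r² = u_r/r` obeys `|(u_r/r)(t, x)| ≤ (9/2)(∫|η₀| · L²)^{1/3}` for EVERY
`x ∈ ℝ³` (off the axis from the radial-momentum bound and `r² · radVelQuot = x₀u₀ + x₁u₁`,
`IsAxisymmetric.cylRadius_sq_mul_radVelQuot`; on the axis by continuity) — the sup-norm statement
`‖u_r/r‖_{L^∞} ≤ C‖ω_θ‖_{L¹(Ω)}^{1/3}‖ω_θ/r‖_{L^∞}^{2/3}` of (2.15) with `C = (9/2)(2π)^{1/3}`.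
[cite: GallaySverak2016, Prop. 2.6 (2.15) (arXiv p. 8) with Lemma 5.1 (p. 16); used p. 17] -/
theorem IsTaoSolutionOn.abs_radVelQuot_le_of_abs_angVortQuot_le (h : IsTaoSolutionOn T ν u₀ u p)
    (hT : 0 < T) (hν : 0 < ν) (h0 : IsAxisymmetric u₀) (h0' : HasNoSwirl u₀)
    (hL1 : Integrable (angVortQuot u₀)) {t : ℝ} (ht : t ∈ Icc 0 T) {L : ℝ}
    (hL : ∀ y, |angVortQuot (u t) y| ≤ L) (x : EuclideanSpace ℝ (Fin 3)) :
    |radVelQuot (u t) x| ≤ 9 / 2 * ((∫ y, |angVortQuot u₀ y|) * L ^ 2) ^ (1 / 3 : ℝ) := by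
  have hax : IsAxisymmetric (u t) := h.isAxisymmetric hν hT h0 t ht
  have hu3 : ContDiff ℝ 3 (u t) := (h.classical.contDiff_velocity ht).of_le (by norm_cast)
  have hu2 : ContDiff ℝ 2 (u t) := hu3.of_le (by norm_cast)
  have hcont : Continuous (radVelQuot (u t)) :=
    (contDiff_radVelQuot (n := 0) (by exact_mod_cast hu2)).continuous
  refine abs_le_of_abs_le_off_axis_of_continuous hcont (fun y hy => ?_) x
  have hq := (h.abs_radialVelocity_le_of_abs_angVortQuot_le hT hν h0 h0' hL1 ht hL y).2
  rw [← hax.cylRadius_sq_mul_radVelQuot hu2 y, abs_mul, abs_of_nonneg (sq_nonneg _)] at hq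
  have hpos : 0 < cylRadius y ^ 2 := pow_pos ((cylRadius_nonneg y).lt_of_ne (Ne.symm hy)) 2
  rw [mul_comm] at hq
  exact le_of_mul_le_mul_right (hq.trans_eq (by ring)) hpos

end Flow





end Literature.Analysis.FluidPDE
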